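import Literature.AnabelianGeometry.EtaleTheta.ThetaTrivializations
import Literature.AnabelianGeometry.EtaleTheta.ThetaKummerClass
import Literature.AnabelianGeometry.EtaleTheta.CyclotomeZHatAction
import Mathlib.RingTheory.RootsOfUnity.PrimitiveRoots
import Mathlib.GroupTheory.SemidirectProduct
import HarnessLib

/-!
# [EtTh] Lem. 1.2 (Compatibility of Theta Trivializations) IN THE KUMMER THEORY OF FUNCTIONS: the
# `s`-dictionary line-bundle datum of a theta-Kummer input, and `Lem12` / `Prop11i` for it

S. Mochizuki, *The étale theta function and its Frobenioid-theoretic manifestations*, Publ. RIMS **45**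
(2009) [EtTh], §1: Lem. 1.2 (PRIMS PDF p. 19, printed 245) with the paragraph before it (p. 18),
Prop. 1.1 (p. 15), Prop. 1.4 (i)/(ii) (p. 22) [cite: MochizukiEtTh2009, Lem 1.2 p.19].  abc-iut cell, layer
L2, seat abc-iut-w5-d171 (gen 7), row «LEM12-FD» (L2-lead R1045).  Companion of abc-iut-L2-t1's statement file
`ThetaTrivializations.lean` (`LineBundleData`, `Prop11i`, `Prop11ii`, `Lem12`; nothing there edited or
restated), of the TOY producer `ThetaTrivializationsToy.lean` (p422532) and of the closure census
`ThetaTrivializationsClosures.lean` (p428265).  Sequel (model instance): `ThetaTrivializationsOfFunctionsModelChi`.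

WHY.  As typed, `Lem12 L` is a predicate on the FREE interface `L : D.LineBundleData` (the formal schemes
`Ÿ_N`, `L̈_N`, `τ_N` have no carrier; plan/FOUNDATIONS.md row 14): instance TOY-witnessed, universal closure
refuted, content in the datum.  Print PROVES Lem. 1.2 (p. 18 l. 1–9) from: (a) `τ_N` is a section with zero
locus `D_N`, unique up to `O^×_{J̈_N}` — so by Prop. 1.4 (i) (`div Θ̈ = (cusps) − D_1 = div s_1 − div τ_1`)
the RATIO `s_N/τ_N` is an `N`-th root of a unit multiple of `Θ̈`; (b) `Π^tp_Y` fixes `D_N`; (c) "the classical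
theory of the theta function … `Θ̈(−Ü) = −Θ̈(Ü)`": `τ_1` may be chosen with `Π^tp_Y` preserving `±τ_1`.  All
three live in the tree's Kummer theory of FUNCTIONS `ThetaSetting.ThetaKummerInput` (abc-iut-L2-t12: a
`Π^tp_X`-module `Fn` of functions on the coverings, `Θ̈ ∈ Fn` fixed by `Π^tp_Ÿ`, a COMPATIBLE SYSTEM of
`N`-th roots `θ_N` of `Θ̈`, constants `K̈^× → Fn`, `Λ(Fn) ≅ Δ_Θ`) plus the deck/sign identity
`ε • Θ̈ = const(−1)·Θ̈` (`ε ∈ Π^tp_Y ∖ Π^tp_Ÿ`), witnessed at `modelχ` by abc-iut-w5-d125's p454127.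

WHAT (ONE definition, then proofs).
* `ThetaKummerInput.lineBundleData T ξ hξ` — **the `s`-dictionary datum**: a section `σ` of `L̈_N^{⊗k}` over a
  covering is recorded by the function `s_N^{⊗k}/σ ∈ Fn`, so the Prop. 1.1 (ii) action (THE action fixing
  `s_N`) is the pull-back action; `IsThetaTriv N τ :⟺ τ^N ∈ K̈^×·Θ̈` ((a)); `powDd = (·)^{N₁/N₂}`, `pullDd = id`;
  `Aut(Ÿ_N, V(L̈_N)) := Fn ⋊ Π^tp_Y` acting by `f ↦ u·(g • f)`, `Preserves a τ :⟺ a·τ = τ`, `actProp11 = inr`;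
  roots of unity act by `k ↦ ξ_{2N}^k` for a generator `ξ` of `Λ(Fn)` (an orientation `Δ_Θ ≅ Ẑ(1)`);
  `AutCompat` = same base, `u₁^{N₁/N₂} = u₂`; the Prop. 1.1 fields are the same dictionary at infinite level.
* `lem12_lineBundleData` (`_of_deck`) — **`Lem12` HOLDS** for it, given `(Θ̈/g•Θ̈)² = 1` on `Π^tp_Y` ((b)+(c))
  and that `ξ` topologically generates `Λ(Fn)`: `τ_N := θ_N`, `ρ_N(g) := (θ_N/g•θ_N, g)`; the discrepancy
  `θ_N/g•θ_N` has `N`-th power `Θ̈/g•Θ̈ = ±1`, and is the `2N`-component of `(n ↦ (θ_n/g•θ_n)²) ∈ Λ(Fn)` —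
  on `Π^tp_Ÿ` the square of the `2N`-component of the Kummer cocycle `(n ↦ θ_n/g•θ_n) ∈ Λ(Fn)`, i.e. an
  `N`-th root of unity: exactly the printed argument.
* `preserves_one_iff_of_mem_GtpYdd` / `preserves_one_iff_of_deck` (`xi_two_eq_const_neg_one`) — **level-1
  sign law**: the only root of unity correcting the Prop. 1.1 (ii) action of `g` into a `τ_1`-preserving one
  is `+1` on `Π^tp_Ÿ` and `−1` off it ("preserves `±τ_1`"); at the toy datum it is `1` throughout.
* `prop11i_lineBundleData` — `Prop11i` HOLDS (trivially: `s₁ ↔ 1`).  **`Prop11ii` is NOT reached**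
  (`not_prop11ii_lineBundleData`): its KERNEL clauses (`Π^tp_{Z_N} ≤ Ker`, `Ker ∩ Δ^tp_X = Δ^tp_{Z_N}`) are
  LEVEL statements needing the functions ON `Z_N` and the faithfulness of `Δ^tp_X/Δ^tp_{Z_N}` there, which a
  theta-Kummer input does not carry; at infinite level (`AutV := Fn ⋊ Π^tp_X`) the compatible action exists,
  is unique, and has trivial kernel, so `Prop11ii` FAILS whenever some `Π^tp_{Z_N} ≠ 1`.

HONEST FRAMING.  A dictionary over a theta-Kummer input, instanced (sequel file) at a SEMI-SYNTHETIC model —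
NOT a curve carrier: `Ÿ_N`, `L̈_N`, `D_N` still have no carrier (FOUNDATIONS row 14 unchanged); the node
classes EtTh:Lem1.2 / Prop1.1 stay FACT-policy (L2 R963/R1032).  It moves the INSTANCE FORMS of F-0653 (and,
trivially, F-0654) from «TOY-witnessed» to «witnessed in the Kummer theory of functions with print's sign
mechanism (`−1 ≠ 1` realised)»; F-0655 stays TOY-witnessed.  Nothing of [EtTh] is asserted; no side is taken on
[IUTchIII] Cor. 3.12; typed ≠ proved.
-/

noncomputable section

namespace Literature.AnabelianGeometry.EtaleTheta

open Literature.AnabelianGeometry.SemiGraphs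

/-! ### Compatible systems: `x_{N₁}^{N₁/N₂} = x_{N₂}` -/

namespace RootSystem

variable {A : Type*} [CommGroup A] {a : A}

/-- `x_{N₁}^{N₁/N₂} = x_{N₂}` for a compatible system of roots and `N₂ ∣ N₁` ("`τ_{N₁}^{⊗N₁/N₂} = τ_{N₂}`",
[EtTh] Lem. 1.2). [cite: MochizukiEtTh2009, Lem 1.2 p.19] -/
theorem root_pow_div (x : RootSystem a) {N₁ N₂ : ℕ+} (h : (N₂ : ℕ) ∣ N₁) :
    x.root N₁ ^ ((N₁ : ℕ) / N₂) = x.root N₂ := by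
  obtain ⟨d, hd⟩ := h
  have hdpos : 0 < d := Nat.pos_of_ne_zero (by rintro rfl; exact PNat.ne_zero N₁ (by simp at hd))
  have hN : N₁ = N₂ * ⟨d, hdpos⟩ := PNat.eq (by simpa using hd)
  have hdiv : (N₁ : ℕ) / N₂ = d := by rw [hd, Nat.mul_div_cancel_left _ N₂.pos]
  rw [hdiv, hN]
  exact x.root_mul_pow N₂ ⟨d, hdpos⟩

end RootSystem

namespace ThetaSetting

namespace ThetaKummerInput

variable {p : ℕ} [Fact p.Prime] {D : ThetaSetting p} (T : D.ThetaKummerInput)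

/-! ### The `s`-dictionary line-bundle datum of a theta-Kummer input -/

/-- **The `s`-dictionary line-bundle datum** of a theta-Kummer input `T` and a generator `ξ` of `Λ(Fn)`
(`ξ_n` a primitive `n`-th root of unity for every `n`): sections of the bundles `L̈_N^{⊗k}` over the
coverings are recorded by functions (`σ ↦ s_N^{⊗k}/σ`), all in the one module `Fn`; "theta
trivialisation at level `N`" `:⟺ τ^N ∈ K̈^× · Θ̈` (Prop. 1.4 (i): `s_1/τ_1 ∈ O^× · Θ̈`);
`Aut(Ÿ_N, V(L̈_N)) := Fn ⋊ Π^tp_Y` acting by `f ↦ u · (g • f)`; `Preserves a τ :⟺ a · τ = τ`; the Prop. 1.1 (ii)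
action is the pull-back `inr` (it fixes `s_N ↔ 1`); `2N`-th roots of unity act by `k ↦ (ξ_{2N}^k, 1)`;
`AutCompat (u₁, g₁) (u₂, g₂) :⟺ g₁ = g₂ ∧ u₁^{N₁/N₂} = u₂`.  The Prop. 1.1 fields are the same dictionary
(`Sec := Fn`, `powN := (·)^N`, `s₁ ↔ 1`, `AutV := Fn ⋊ Π^tp_X`, "compatible with `s_N`" := covers the
tautological base action and fixes `s_N`). An INTERPRETATION of the free interface; nothing of print is
asserted. [cite: MochizukiEtTh2009, Lem 1.2 p.19] -/
def lineBundleData (ξ : cyclotome T.Fn) (hξ : ∀ N : ℕ+, IsPrimitiveRoot ((ξ : ℕ+ → T.Fn) N) N) :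
    D.LineBundleData where
  SecPow _ := T.Fn
  Sec _ := T.Fn
  powN N f := f ^ (N : ℕ)
  s₁res _ := 1
  AutV _ := T.Fn ⋊[MulDistribMulAction.toMulAut D.PiTemp T.Fn] D.PiTemp
  IsCompatibleWith _ ρ s := ∀ g, (ρ g).right = g ∧ (ρ g).left * (g • s) = s
  SecDd _ := T.Fn
  IsThetaTriv N f := ∃ c : (↥D.Kdd)ˣ, f ^ (N : ℕ) = T.const c * T.theta
  SecMix _ _ _ := T.Fn
  powDd N₁ N₂ _ f := f ^ ((N₁ : ℕ) / N₂)
  pullDd _ _ _ f := f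
  AutVdd _ := T.Fn ⋊[(MulDistribMulAction.toMulAut D.PiTemp T.Fn).comp D.GtpY.subtype] D.GtpY
  Preserves _ a f := a.left * ((a.right : D.PiTemp) • f) = f
  rootAct N := SemidirectProduct.inl.comp
    { toFun := fun k => (ξ : ℕ+ → T.Fn) (2 * N) ^ (Multiplicative.toAdd k).val
      map_one' := by rw [toAdd_one, ZMod.val_zero, pow_zero]
      map_mul' := fun a b => by
        haveI : NeZero ((2 * N : ℕ+) : ℕ) := ⟨PNat.ne_zero _⟩
        rw [toAdd_mul, ZMod.val_add, ← pow_add]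
        exact cyclotome.pow_val_eq_pow_of_mod_eq (cyclotome.pow_eq_one ξ (2 * N)) (Nat.mod_mod _ _) }
  rootAct_injective N := by
    intro a b hab
    haveI : NeZero ((2 * N : ℕ+) : ℕ) := ⟨PNat.ne_zero _⟩
    have h : (ξ : ℕ+ → T.Fn) (2 * N) ^ (Multiplicative.toAdd a).val =
        (ξ : ℕ+ → T.Fn) (2 * N) ^ (Multiplicative.toAdd b).val := SemidirectProduct.inl_injective hab
    exact Multiplicative.toAdd.injective
      (ZMod.val_injective _ ((hξ (2 * N)).pow_inj (ZMod.val_lt _) (ZMod.val_lt _) h))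
  AutCompat N₁ N₂ _ a b := a.right = b.right ∧ a.left ^ ((N₁ : ℕ) / N₂) = b.left
  actProp11 _ := SemidirectProduct.inr

variable (ξ : cyclotome T.Fn) (hξ : ∀ N : ℕ+, IsPrimitiveRoot ((ξ : ℕ+ → T.Fn) N) N)

/-- `Preserves`, unfolded: `(u, g)` preserves `τ` iff `u · (g • τ) = τ`. [cite: MochizukiEtTh2009, Lem 1.2 p.19] -/
theorem lineBundleData_preserves_iff (N : ℕ+) (a : (T.lineBundleData ξ hξ).AutVdd N) (f : T.Fn) :
    (T.lineBundleData ξ hξ).Preserves N a f ↔ a.left * ((a.right : D.PiTemp) • f) = f := Iff.rfl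

/-- `rootAct k · actProp11 g = (ξ_{2N}^k, g)`. [cite: MochizukiEtTh2009, Lem 1.2 p.19] -/
theorem lineBundleData_rootAct_mul_actProp11 (N : ℕ+) (k : Multiplicative (ZMod (2 * N))) (g : D.GtpY) :
    (T.lineBundleData ξ hξ).rootAct N k * (T.lineBundleData ξ hξ).actProp11 N g =
      (⟨(ξ : ℕ+ → T.Fn) (2 * N) ^ (Multiplicative.toAdd k).val, g⟩ :
        T.Fn ⋊[(MulDistribMulAction.toMulAut D.PiTemp T.Fn).comp D.GtpY.subtype] D.GtpY) := by
  exact SemidirectProduct.inl_left_mul_inr_right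
    (⟨(ξ : ℕ+ → T.Fn) (2 * N) ^ (Multiplicative.toAdd k).val, g⟩ :
      T.Fn ⋊[(MulDistribMulAction.toMulAut D.PiTemp T.Fn).comp D.GtpY.subtype] D.GtpY)

/-- `ξ_{2N}` raised to the class of an integer `k` is `ξ_{2N}^k`. [cite: LANA2026Report, §6.1 p.31] -/
theorem xi_pow_val_intCast (N : ℕ+) (k : ℤ) :
    (ξ : ℕ+ → T.Fn) (2 * N) ^ ((k : ZMod (2 * N))).val = (ξ : ℕ+ → T.Fn) (2 * N) ^ k := by
  haveI : NeZero (2 * (N : ℕ)) := ⟨Nat.mul_ne_zero two_ne_zero (PNat.ne_zero N)⟩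
  have h : (ξ : ℕ+ → T.Fn) (2 * N) ^ (2 * (N : ℕ)) = 1 := cyclotome.pow_eq_one ξ (2 * N)
  rw [← zpow_natCast, ZMod.val_intCast, ← zpow_eq_zpow_emod' k h]

/-! ### Prop. 1.1 for the `s`-dictionary datum: (i) holds, (ii) is not reached -/

/-- **Prop. 1.1 (i) holds for the `s`-dictionary datum** — trivially: `s₁ ↔ 1` and `1` is an `N`-th root of
`1`. [cite: MochizukiEtTh2009, Prop 1.1 (i) p.15] -/
theorem prop11i_lineBundleData : Prop11i (T.lineBundleData ξ hξ) := fun N =>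
  ⟨(1 : T.Fn), (one_pow (N : ℕ) : (1 : T.Fn) ^ (N : ℕ) = 1)⟩

/-- **Prop. 1.1 (ii) is NOT reached by the `s`-dictionary datum**: at infinite level the (unique) compatible
action `g ↦ (s_N/g•s_N, g)` has trivial kernel, so the level clause `Π^tp_{Z_N} ≤ Ker` fails as soon as some
`Π^tp_{Z_N} ≠ 1` (reaching it needs the functions ON `Z_N` and the faithfulness of `Δ^tp_X/Δ^tp_{Z_N}` there).
[cite: MochizukiEtTh2009, Prop 1.1 (ii) p.15] -/
theorem not_prop11ii_lineBundleData (hZ : ∃ N, D.GtpZN N ≠ ⊥) : ¬ Prop11ii (T.lineBundleData ξ hξ) := by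
  intro h
  obtain ⟨N, hN⟩ := hZ
  apply hN
  rw [eq_bot_iff]
  intro g hg
  obtain ⟨ρ, hρ, -, hker, -⟩ := h N (1 : T.Fn) (one_pow (N : ℕ) : (1 : T.Fn) ^ (N : ℕ) = 1)
  have h1 : ρ g = 1 := (MonoidHom.mem_ker).mp (hker hg)
  have h2 : (ρ g).right = g := (hρ g).1
  rw [h1] at h2
  exact Subgroup.mem_bot.mpr h2.symm

/-! ### Lem. 1.2 for the `s`-dictionary datum -/

/-- **[EtTh] Lem. 1.2 holds for the `s`-dictionary datum of a theta-Kummer input**, provided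
`(Θ̈ / g•Θ̈)² = 1` for `g ∈ Π^tp_Y` (print: `Π^tp_Y` fixes `D_N` and `Θ̈(−Ü) = −Θ̈(Ü)`) and `ξ` topologically
generates `Λ(Fn)` (every level-`N` component of an element of `Λ(Fn)` is a power of `ξ_N`).  Witnesses:
`τ_N := θ_N` (the compatible roots of `Θ̈`), `ρ_N(g) := (θ_N / g•θ_N, g)`; the discrepancy `θ_N / g•θ_N` is
the `2N`-component of `(n ↦ (θ_n / g•θ_n)²) ∈ Λ(Fn)`, and on `Π^tp_Ÿ` the square of the `2N`-component of the
Kummer cocycle `(n ↦ θ_n / g•θ_n) ∈ Λ(Fn)`. [cite: MochizukiEtTh2009, Lem 1.2 p.19] -/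
theorem lem12_lineBundleData
    (hgen : ∀ (x : cyclotome T.Fn) (N : ℕ+), ∃ k : ℤ, (x : ℕ+ → T.Fn) N = (ξ : ℕ+ → T.Fn) N ^ k)
    (hsq : ∀ g : D.PiTemp, g ∈ D.GtpY → (T.theta / (g • T.theta)) ^ 2 = 1) :
    Lem12 (T.lineBundleData ξ hξ) := by
  -- the discrepancy `w_N(g) := θ_N / g•θ_N` and its algebra
  let θ : ℕ+ → T.Fn := fun N => T.thetaRoots.root N
  let w : ℕ+ → D.GtpY → T.Fn := fun N g => θ N / ((g : D.PiTemp) • θ N)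
  have w_def : ∀ N (g : D.GtpY), w N g = θ N / ((g : D.PiTemp) • θ N) := fun _ _ => rfl
  have w_mul : ∀ N (g h : D.GtpY), w N (g * h) = w N g * ((g : D.PiTemp) • w N h) := by
    intro N g h
    rw [w_def, w_def, w_def, Subgroup.coe_mul, mul_smul, smul_div', div_mul_div_cancel]
  have w_pow_self : ∀ N (g : D.GtpY), w N g ^ (N : ℕ) = T.theta / ((g : D.PiTemp) • T.theta) := by
    intro N g
    rw [w_def, div_pow, ← smul_pow', T.thetaRoots.pow_self]
  have w_pow : ∀ (N m : ℕ+) (g : D.GtpY), w (N * m) g ^ (m : ℕ) = w N g := by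
    intro N m g
    rw [w_def, w_def, div_pow, ← smul_pow', T.thetaRoots.root_mul_pow]
  have w_pow_div : ∀ {N₁ N₂ : ℕ+} (_ : (N₂ : ℕ) ∣ N₁) (g : D.GtpY),
      w N₁ g ^ ((N₁ : ℕ) / N₂) = w N₂ g := by
    intro N₁ N₂ h g
    rw [w_def, w_def, div_pow, ← smul_pow', T.thetaRoots.root_pow_div h]
  have w_two : ∀ N (g : D.GtpY), w (2 * N) g ^ 2 = w N g := by
    intro N g
    rw [show (2 * N : ℕ+) = N * 2 from mul_comm _ _]
    exact w_pow N 2 g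
  -- `n ↦ w_n(g)²` is a compatible system of roots of unity, for `g ∈ Π^tp_Y`
  have sq_mem : ∀ g : D.GtpY, (fun n => w n g ^ 2) ∈ cyclotome T.Fn := by
    intro g
    refine ⟨fun n => ?_, fun n m => ?_⟩
    · change (w n g ^ 2) ^ (n : ℕ) = 1
      rw [pow_right_comm, w_pow_self, hsq _ g.2]
    · change (w (n * m) g ^ 2) ^ (m : ℕ) = w n g ^ 2
      rw [pow_right_comm, w_pow]
  -- `n ↦ w_n(g)` itself is, for `g ∈ Π^tp_Ÿ` (the Kummer cocycle of `Θ̈`)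
  have dd_mem : ∀ g : D.GtpY, (g : D.PiTemp) ∈ D.GtpYdd → (fun n => w n g) ∈ cyclotome T.Fn := by
    intro g hg
    refine ⟨fun n => ?_, fun n m => ?_⟩
    · change w n g ^ (n : ℕ) = 1
      rw [w_pow_self, show ((g : D.PiTemp)) • T.theta = T.theta from T.theta_mem ⟨(g : D.PiTemp), hg⟩,
        div_self']
    · exact w_pow n m g
  -- the `τ_N`-preserving actions
  let ρ : ∀ N : ℕ+,
      D.GtpY →* (T.Fn ⋊[(MulDistribMulAction.toMulAut D.PiTemp T.Fn).comp D.GtpY.subtype] D.GtpY) :=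
    fun N =>
      { toFun := fun g => ⟨w N g, g⟩
        map_one' := by
          ext
          · change w N 1 = 1
            rw [w_def, Subgroup.coe_one, one_smul, div_self']
          · rfl
        map_mul' := fun g h => by
          ext
          · change w N (g * h) = w N g * ((MulDistribMulAction.toMulAut D.PiTemp T.Fn).comp D.GtpY.subtype g)
              (w N h)
            rw [w_mul]
            rfl
          · rfl }
  refine ⟨θ, fun N => ?_, fun N₁ N₂ h => ?_, ρ, fun N g => ?_, fun N₁ N₂ h g => ?_, fun N g => ?_,
    fun N g hg => ?_⟩
  · -- C1: `θ_N^N = Θ̈ = const 1 · Θ̈`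
    exact ⟨1, by rw [map_one, one_mul]; exact T.thetaRoots.pow_self N⟩
  · -- C1: compatibility `θ_{N₁}^{N₁/N₂} = θ_{N₂}`
    exact T.thetaRoots.root_pow_div h
  · -- C2: `ρ_N(g)` preserves `θ_N`
    change w N g * ((g : D.PiTemp) • θ N) = θ N
    rw [w_def, div_mul_cancel]
  · -- C2: compatibility of `ρ_{N₁}(g)` and `ρ_{N₂}(g)`
    exact ⟨rfl, w_pow_div h g⟩
  · -- C3: the discrepancy is a `2N`-th root of unity `ξ_{2N}^k`
    obtain ⟨k, hk⟩ := hgen ⟨_, sq_mem g⟩ (2 * N)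
    refine ⟨Multiplicative.ofAdd (k : ZMod (2 * N)), ?_⟩
    show (⟨w N g, g⟩ : T.Fn ⋊[(MulDistribMulAction.toMulAut D.PiTemp T.Fn).comp D.GtpY.subtype] D.GtpY) =
      SemidirectProduct.inl ((ξ : ℕ+ → T.Fn) (2 * N) ^
          (Multiplicative.toAdd (Multiplicative.ofAdd (k : ZMod (2 * N)))).val) *
        SemidirectProduct.inr g
    rw [toAdd_ofAdd, T.xi_pow_val_intCast ξ N k, ← hk, ← SemidirectProduct.inl_left_mul_inr_right ⟨w N g, g⟩]
    congr 2
    exact (w_two N g).symm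
  · -- C3, `Π^tp_Ÿ`-refinement: the discrepancy is the SQUARE `ξ_{2N}^{2j}`
    obtain ⟨j, hj⟩ := hgen ⟨_, dd_mem ⟨g, D.GtpYN_le _ ((inf_le_left : D.GtpYddN 1 ≤ D.GtpYN (2 * 1)) hg)⟩ hg⟩
      (2 * N)
    refine ⟨Multiplicative.ofAdd (j : ZMod (2 * N)), ?_⟩
    show (⟨w N _, _⟩ : T.Fn ⋊[(MulDistribMulAction.toMulAut D.PiTemp T.Fn).comp D.GtpY.subtype] D.GtpY) =
      SemidirectProduct.inl ((ξ : ℕ+ → T.Fn) (2 * N) ^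
          (Multiplicative.toAdd (Multiplicative.ofAdd (j : ZMod (2 * N)) *
            Multiplicative.ofAdd (j : ZMod (2 * N)))).val) *
        SemidirectProduct.inr _
    rw [← ofAdd_add, toAdd_ofAdd, ← Int.cast_add, T.xi_pow_val_intCast ξ N (j + j), ← two_mul, zpow_mul',
      zpow_ofNat, ← hj, ← SemidirectProduct.inl_left_mul_inr_right ⟨w N _, _⟩]
    congr 2
    exact (w_two N _).symm

/-- The hypothesis `(Θ̈ / g•Θ̈)² = 1` on `Π^tp_Y` follows from the DECK/SIGN identity of Prop. 1.4 (ii)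
(`ε • Θ̈ = const(−1) · Θ̈` off `Π^tp_Ÿ`) and `Θ̈ ∈ Fn^{Π^tp_Ÿ}`. [cite: MochizukiEtTh2009, Prop 1.4 (ii) p.22] -/
theorem sq_eq_one_of_deck
    (hdeck : ∀ ε : D.PiTemp, ε ∈ D.GtpY → ε ∉ D.GtpYdd → ε • T.theta = T.const (-1) * T.theta)
    (g : D.PiTemp) (hg : g ∈ D.GtpY) : (T.theta / (g • T.theta)) ^ 2 = 1 := by
  by_cases hdd : g ∈ D.GtpYdd
  · rw [show g • T.theta = T.theta from T.theta_mem ⟨g, hdd⟩, div_self', one_pow]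
  · rw [hdeck g hg hdd, div_mul_cancel_right, inv_pow, ← map_pow, neg_one_sq, map_one, inv_one]

/-- **Lem. 1.2 for the `s`-dictionary datum, from the deck identity.** [cite: MochizukiEtTh2009, Lem 1.2 p.19] -/
theorem lem12_lineBundleData_of_deck
    (hgen : ∀ (x : cyclotome T.Fn) (N : ℕ+), ∃ k : ℤ, (x : ℕ+ → T.Fn) N = (ξ : ℕ+ → T.Fn) N ^ k)
    (hdeck : ∀ ε : D.PiTemp, ε ∈ D.GtpY → ε ∉ D.GtpYdd → ε • T.theta = T.const (-1) * T.theta) :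
    Lem12 (T.lineBundleData ξ hξ) :=
  T.lem12_lineBundleData ξ hξ hgen (T.sq_eq_one_of_deck hdeck)

/-! ### Level-1 non-vacuity: the correcting root of unity is the sign of `Ÿ → Y` -/

include hξ in
/-- With a non-trivial constant `−1`, the generator's square root of unity IS `const(−1)`: the system
`n ↦ (root_n(−1))²` lies in `Λ(Fn)` with `2`-component `const(−1)`, which is thus a power of the order-`2`
element `ξ_2`. [cite: MochizukiEtTh2009, Prop 1.4 (ii) p.22] -/
theorem xi_two_eq_const_neg_one
    (hgen : ∀ (x : cyclotome T.Fn) (N : ℕ+), ∃ k : ℤ, (x : ℕ+ → T.Fn) N = (ξ : ℕ+ → T.Fn) N ^ k)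
    (hneg : T.const (-1) ≠ 1) : (ξ : ℕ+ → T.Fn) (2 * 1) = T.const (-1) := by
  have hmem : (fun n => (T.constRoots (-1)).root n ^ 2) ∈ cyclotome T.Fn := by
    refine ⟨fun n => ?_, fun n m => ?_⟩
    · change ((T.constRoots (-1)).root n ^ 2) ^ (n : ℕ) = 1
      rw [pow_right_comm, (T.constRoots (-1)).pow_self, ← map_pow, neg_one_sq, map_one]
    · change ((T.constRoots (-1)).root (n * m) ^ 2) ^ (m : ℕ) = (T.constRoots (-1)).root n ^ 2
      rw [pow_right_comm, (T.constRoots (-1)).root_mul_pow]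
  obtain ⟨k, hk⟩ := hgen ⟨_, hmem⟩ (2 * 1)
  have hx : (T.constRoots (-1)).root (2 * 1) ^ 2 = T.const (-1) := by
    have h := (T.constRoots (-1)).root_mul_pow 1 2
    rw [(T.constRoots (-1)).root_one] at h
    exact h
  change (T.constRoots (-1)).root (2 * 1) ^ 2 = _ at hk
  rw [hx] at hk
  have h2 : (ξ : ℕ+ → T.Fn) (2 * 1) ^ 2 = 1 := (hξ (2 * 1)).pow_eq_one
  rw [hk, zpow_eq_zpow_emod' k h2]
  rcases Int.emod_two_eq_zero_or_one k with he | ho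
  · exfalso
    apply hneg
    rw [hk, zpow_eq_zpow_emod' k h2]
    norm_num [he]
  · norm_num [ho]

/-- **On `Π^tp_Ÿ` the correcting root is `+1`:** for `g ∈ Π^tp_Ÿ`, `rootAct ζ · actProp11 g` preserves
`τ_1 = θ_1 = Θ̈` iff `ζ = 1` (in `μ_2`). [cite: MochizukiEtTh2009, Lem 1.2 p.19] -/
theorem preserves_one_iff_of_mem_GtpYdd {g : D.PiTemp} (hgY : g ∈ D.GtpY) (hg : g ∈ D.GtpYdd)
    (ζ : Multiplicative (ZMod (2 * ((1 : ℕ+) : ℕ)))) :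
    (T.lineBundleData ξ hξ).Preserves 1
        ((T.lineBundleData ξ hξ).rootAct 1 ζ * (T.lineBundleData ξ hξ).actProp11 1 ⟨g, hgY⟩)
        (T.thetaRoots.root 1) ↔ ζ = 1 := by
  haveI : NeZero (2 * ((1 : ℕ+) : ℕ)) := ⟨by decide⟩
  have hv : ζ = 1 ↔ (Multiplicative.toAdd ζ).val = 0 := by
    rw [ZMod.val_eq_zero]
    exact ⟨fun h => by rw [h, toAdd_one], fun h => Multiplicative.toAdd.injective (h.trans toAdd_one.symm)⟩
  have hlt : (Multiplicative.toAdd ζ).val < 2 := ZMod.val_lt _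
  rw [T.lineBundleData_rootAct_mul_actProp11 ξ hξ, T.lineBundleData_preserves_iff ξ hξ, T.thetaRoots.root_one]
  change (ξ : ℕ+ → T.Fn) (2 * 1) ^ (Multiplicative.toAdd ζ).val * (g • T.theta) = T.theta ↔ _
  rw [show g • T.theta = T.theta from T.theta_mem ⟨g, hg⟩, mul_eq_right, (hξ (2 * 1)).pow_eq_one_iff_dvd]
  change 2 ∣ (Multiplicative.toAdd ζ).val ↔ _
  rw [hv]
  omega

/-- **Off `Π^tp_Ÿ` the correcting root is `−1`:** for `g ∈ Π^tp_Y` satisfying the deck identity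
`g • Θ̈ = const(−1) · Θ̈` (so `g ∉ Π^tp_Ÿ`), `rootAct ζ · actProp11 g` preserves `τ_1 = Θ̈` iff `ζ ≠ 1`, i.e.
`ζ = −1 ∈ μ_2` — "one may choose `τ_1` so that … preserves `±τ_1`" (p. 18). [cite: MochizukiEtTh2009, Lem 1.2 p.19] -/
theorem preserves_one_iff_of_deck
    (hgen : ∀ (x : cyclotome T.Fn) (N : ℕ+), ∃ k : ℤ, (x : ℕ+ → T.Fn) N = (ξ : ℕ+ → T.Fn) N ^ k)
    (hneg : T.const (-1) ≠ 1) {g : D.PiTemp} (hgY : g ∈ D.GtpY)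
    (hdeck : g • T.theta = T.const (-1) * T.theta) (ζ : Multiplicative (ZMod (2 * ((1 : ℕ+) : ℕ)))) :
    (T.lineBundleData ξ hξ).Preserves 1
        ((T.lineBundleData ξ hξ).rootAct 1 ζ * (T.lineBundleData ξ hξ).actProp11 1 ⟨g, hgY⟩)
        (T.thetaRoots.root 1) ↔ ζ ≠ 1 := by
  haveI : NeZero (2 * ((1 : ℕ+) : ℕ)) := ⟨by decide⟩
  have hv : ζ = 1 ↔ (Multiplicative.toAdd ζ).val = 0 := by
    rw [ZMod.val_eq_zero]
    exact ⟨fun h => by rw [h, toAdd_one], fun h => Multiplicative.toAdd.injective (h.trans toAdd_one.symm)⟩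
  have hlt : (Multiplicative.toAdd ζ).val < 2 := ZMod.val_lt _
  rw [T.lineBundleData_rootAct_mul_actProp11 ξ hξ, T.lineBundleData_preserves_iff ξ hξ, T.thetaRoots.root_one]
  change (ξ : ℕ+ → T.Fn) (2 * 1) ^ (Multiplicative.toAdd ζ).val * (g • T.theta) = T.theta ↔ _
  rw [hdeck, ← mul_assoc, mul_eq_right, ← T.xi_two_eq_const_neg_one ξ hξ hgen hneg, ← pow_succ,
    (hξ (2 * 1)).pow_eq_one_iff_dvd]
  change 2 ∣ (Multiplicative.toAdd ζ).val + 1 ↔ ¬ (ζ = 1)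
  rw [hv]
  omega

end ThetaKummerInput

end ThetaSetting

end Literature.AnabelianGeometry.EtaleTheta

end
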